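import Summits.KontsevichZagierPeriods.KontsevichZagierPeriods.Theorems.HurwitzMicroSectorsNormalFormPrincipleEvenZetaLayer
import Summits.KontsevichZagierPeriods.KontsevichZagierPeriods.Theorems.HurwitzMicroSectorsNormalFormPrincipleDilogLevelOneKernel
import Summits.KontsevichZagierPeriods.KontsevichZagierPeriods.Theorems.HurwitzMicroSectorsNormalFormPrincipleM4KernelRefs
import Summits.KontsevichZagierPeriods.KontsevichZagierPeriods.Theorems.HurwitzMicroSectorsNormalFormPrincipleM4KernelReduceZeta
import Summits.KontsevichZagierPeriods.KontsevichZagierPeriods.Theorems.HurwitzMicroSectorsNormalFormPrincipleM4KernelReduceLog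
import Summits.KontsevichZagierPeriods.KontsevichZagierPeriods.Theorems.HurwitzMicroSectorsNormalFormPrincipleLevelOneBoxPolyExistsPt
import Summits.KontsevichZagierPeriods.KontsevichZagierPeriods.Theorems.MzvKernelInKZ.Negative.ScalingDivision
import Summits.KontsevichZagierPeriods.KontsevichZagierPeriods.Theorems.HyperbolicBlochOffTetraSectorKernelStubAffineOrbit

/-!
# `NormalFormPrinciple` (stmt-KontsevichZagierPeriods-3869), line `SketchIdeator1` —
# leaf `stub_boxRigidity`: the `π`-POWERS KERNEL (unconditional, all layers of value space `ℚ̄[π²]`)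

Pure proof file (lead seat c9; `--supports` the crux). The even zeta values layer proves Conjecture 1
UNCONDITIONALLY (Lindemann), jointly over all even weights, on the subgroup generated by the diagonal
level-one boxes `[□^{2k}, P(Πx)/(1 − Πx)]` (`P ∈ (ℚ̄ ∩ ℝ)[t]`), the constant boxes and the algebraic
points (`EvenZeta.evenZeta_mem_relations_of_eval_eq_zero_of_mem_closure`). This file ADJOINS to that
subgroup every family of this line whose members are individually congruent, modulo `KZ.relations`,
to elements of it — so that a vanishing value still forces a relation (the extended subgroup lies in
`⟨even zeta⟩ ⊔ relations`):

* all rational polynomial boxes `[□ᵐ, p]`, any `m` (`≡ [pt, ∫p]`, `LevelOne.boxPoly_exists_pt`);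
* the level-one boxes of dimension two with ARBITRARY two-variable numerators `[□², P(x,y)/(1−xy)]`
  (`≡ [□², β/(1−xy)] + [pt, q]`, `LevelOne.levelOne_reduce`);
* the level-two dilogarithm boxes `[□², 1/(1+xy)]`, `[□², 4xy/(1−x²y²)]`, `[□², 1/(−1−xy)]`
  (`≡ [□², β/(1−xy)]`, `β = 1/2, 1, −1/2`; `Dilog.dlk_*`);
* the seven `ζ(4)`-valued level-two families of dimension four `[□⁴, 1/(1∓Π)]`,
  `[□⁴, 1/((1−xy)(1−Π))]`, `[□⁴, 1/((1−xyz)(1−Π))]`, `[□⁴, 1/((1−xy)(1∓zw))]`, `[□⁴, 1/((1+xy)(1+zw))]`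
  (`8[N] ≡ α[□⁴, 1/(1−Π)]`, `m4k4_reduce_zeta/log`, hence `[N] ≡ [□⁴, (α/8)/(1−Π)]` after division by
  `8` through the scaling move).

Values covered: the `ℚ̄`-span of `1, π², π⁴, …` as realised by all these boxes; no hypothesis.
References: M. Kontsevich, D. Zagier, *Periods* (2001), §1.2 (Conjecture 1); F. Lindemann (1882).
No definitions are introduced.
-/

noncomputable section

open MeasureTheory Set
open Literature.NumberTheory.Transcendental Literature.NumberTheory.Transcendental.KZ
open Summit.KontsevichZagierPeriods.MzvKernelInKZ.Negative (mem_relations_of_nsmul_mem)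
open Summit.KontsevichZagierPeriods.HyperbolicBloch.OffTetraSectorKernel
  (aff_orbit_of_sub_sum_zsmul_mem_relations)
open Summit.KontsevichZagierPeriods.HurwitzMicroSectors.NormalFormPrinciple.PiBox.Dlog
  (exists_ptCarrier)
open Summit.KontsevichZagierPeriods.HurwitzMicroSectors.NormalFormPrinciple.PiBox.LevelOne
  (exists_zetaTwoRep levelOne_reduce boxPoly_exists_pt)
open Summit.KontsevichZagierPeriods.HurwitzMicroSectors.NormalFormPrinciple.PiBox.Dilog
  (dlk_etaTwo_sub_half dlk_squares_sub_one dlk_negBox_add_half)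
open Summit.KontsevichZagierPeriods.HurwitzMicroSectors.NormalFormPrinciple.PiBox.EvenZeta
  (evenZeta_mem_relations_of_eval_eq_zero_of_mem_closure)

namespace Summit.KontsevichZagierPeriods.HurwitzMicroSectors.NormalFormPrinciple.PiBox.M3

/-- **The `π`-powers kernel** (lead seat c9, line `SketchIdeator1`): CONJECTURE 1 OF
KONTSEVICH–ZAGIER HOLDS UNCONDITIONALLY, in kernel form, on the subgroup of the formal period group
generated by the even zeta values layer (diagonal level-one boxes of all even weights with
`ℚ̄`-polynomial numerators, constant boxes, algebraic points), all rational polynomial boxes, the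
level-one boxes of dimension two with arbitrary `ℚ`-polynomial numerators, the three level-two
dilogarithm boxes and the seven `ζ(4)`-valued level-two families of dimension four: a formal
`ℤ`-combination of such representations with value `0` is a relation. [cite: KontsevichZagier2001, §1.2 Conjecture 1] -/
theorem piPowers_mem_relations_of_eval_eq_zero {c : FormalRep}
    (hc : c ∈ AddSubgroup.closure
      ({y : FormalRep | ∃ (k : ℕ) (S : Finset ℕ) (coef : ℕ → ℝ) (N : IntegralRep (2 * (k + 1))),
          (∀ i ∈ S, IsAlgebraic ℚ (coef i)) ∧ N.domain = {x | ∀ i, x i ∈ Set.Ioo (0:ℝ) 1} ∧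
          EqOn N.integrand (fun x => (∑ i ∈ S, coef i * (∏ l, x l) ^ i) / (1 - ∏ l, x l)) N.domain ∧
          y = of N} ∪
       {y : FormalRep | ∃ (w : ℕ) (c : ℝ) (N : IntegralRep w), IsAlgebraic ℚ c ∧
          N.domain = {x | ∀ i, x i ∈ Set.Ioo (0:ℝ) 1} ∧ EqOn N.integrand (fun _ => c) N.domain ∧ y = of N} ∪
       {y : FormalRep | ∃ (r : ℝ) (Z : IntegralRep 0), IsAlgebraic ℚ r ∧ Z.domain = Set.univ ∧
          (Z.integrand = fun _ => r) ∧ y = of Z} ∪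
       {y : FormalRep | ∃ (m : ℕ) (p : MvPolynomial (Fin m) ℚ) (N : IntegralRep m),
          N.domain = {x | ∀ i, x i ∈ Set.Ioo (0:ℝ) 1} ∧
          EqOn N.integrand (fun x => (MvPolynomial.aeval x p : ℝ)) N.domain ∧ y = of N} ∪
       {y : FormalRep | ∃ (P : MvPolynomial (Fin 2) ℚ) (N : IntegralRep 2),
          N.domain = {x | ∀ i, x i ∈ Set.Ioo (0:ℝ) 1} ∧
          EqOn N.integrand (fun x => (MvPolynomial.aeval x P : ℝ) / (1 - x 0 * x 1)) N.domain ∧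
          y = of N} ∪
       {y : FormalRep | ∃ N : IntegralRep 2, N.domain = {x | ∀ i, x i ∈ Set.Ioo (0:ℝ) 1} ∧
          EqOn N.integrand (fun x => 1 / (1 + x 0 * x 1)) N.domain ∧ y = of N} ∪
       {y : FormalRep | ∃ N : IntegralRep 2, N.domain = {x | ∀ i, x i ∈ Set.Ioo (0:ℝ) 1} ∧
          EqOn N.integrand (fun x => 4 * x 0 * x 1 / (1 - x 0 ^ 2 * x 1 ^ 2)) N.domain ∧ y = of N} ∪
       {y : FormalRep | ∃ N : IntegralRep 2, N.domain = {x | ∀ i, x i ∈ Set.Ioo (0:ℝ) 1} ∧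
          EqOn N.integrand (fun x => 1 / (-1 - x 0 * x 1)) N.domain ∧ y = of N} ∪
       {y : FormalRep | ∃ N : IntegralRep 4, N.domain = {x | ∀ i, x i ∈ Set.Ioo (0:ℝ) 1} ∧
          EqOn N.integrand (fun x => 1 / (1 - x 0 * x 1 * x 2 * x 3)) N.domain ∧ y = of N} ∪
       {y : FormalRep | ∃ N : IntegralRep 4, N.domain = {x | ∀ i, x i ∈ Set.Ioo (0:ℝ) 1} ∧
          EqOn N.integrand (fun x => 1 / (1 + x 0 * x 1 * x 2 * x 3)) N.domain ∧ y = of N} ∪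
       {y : FormalRep | ∃ N : IntegralRep 4, N.domain = {x | ∀ i, x i ∈ Set.Ioo (0:ℝ) 1} ∧
          EqOn N.integrand (fun x => 1 / ((1 - x 0 * x 1) * (1 - x 0 * x 1 * x 2 * x 3))) N.domain ∧ y = of N} ∪
       {y : FormalRep | ∃ N : IntegralRep 4, N.domain = {x | ∀ i, x i ∈ Set.Ioo (0:ℝ) 1} ∧
          EqOn N.integrand (fun x => 1 / ((1 - x 0 * x 1 * x 2) * (1 - x 0 * x 1 * x 2 * x 3))) N.domain ∧ y = of N} ∪
       {y : FormalRep | ∃ N : IntegralRep 4, N.domain = {x | ∀ i, x i ∈ Set.Ioo (0:ℝ) 1} ∧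
          EqOn N.integrand (fun x => 1 / ((1 - x 0 * x 1) * (1 - x 2 * x 3))) N.domain ∧ y = of N} ∪
       {y : FormalRep | ∃ N : IntegralRep 4, N.domain = {x | ∀ i, x i ∈ Set.Ioo (0:ℝ) 1} ∧
          EqOn N.integrand (fun x => 1 / ((1 - x 0 * x 1) * (1 + x 2 * x 3))) N.domain ∧ y = of N} ∪
       {y : FormalRep | ∃ N : IntegralRep 4, N.domain = {x | ∀ i, x i ∈ Set.Ioo (0:ℝ) 1} ∧
          EqOn N.integrand (fun x => 1 / ((1 + x 0 * x 1) * (1 + x 2 * x 3))) N.domain ∧ y = of N}))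
    (hv : eval c = 0) : c ∈ relations := by
  classical
  obtain ⟨Zf, hZf⟩ := exists_ptCarrier
  obtain ⟨Z4, C1, Z3, hZ4d, hZ4i, -, hC1d, hC1i, hZ3d, hZ3i, -⟩ := m4r4_exists_refs
  obtain ⟨r1, r2, r3, r4, r5⟩ := m4k4_reduce_zeta Z4 C1 Z3 hZ4d hZ4i hC1d hC1i hZ3d hZ3i
  obtain ⟨-, -, r8, r9⟩ := m4k4_reduce_log Z4 C1 Z3 hZ4d hZ4i hC1d hC1i hZ3d hZ3i
  -- membership of the standard carriers in the even zeta subgroup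
  have hpt : ∀ q : ℚ, of (Zf q) ∈ AddSubgroup.closure ({y : FormalRep | ∃ (k : ℕ) (S : Finset ℕ) (coef : ℕ → ℝ) (N : IntegralRep (2 * (k + 1))),
          (∀ i ∈ S, IsAlgebraic ℚ (coef i)) ∧ N.domain = {x | ∀ i, x i ∈ Set.Ioo (0:ℝ) 1} ∧
          EqOn N.integrand (fun x => (∑ i ∈ S, coef i * (∏ l, x l) ^ i) / (1 - ∏ l, x l)) N.domain ∧
          y = of N} ∪
       {y : FormalRep | ∃ (w : ℕ) (c : ℝ) (N : IntegralRep w), IsAlgebraic ℚ c ∧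
          N.domain = {x | ∀ i, x i ∈ Set.Ioo (0:ℝ) 1} ∧ EqOn N.integrand (fun _ => c) N.domain ∧ y = of N} ∪
       {y : FormalRep | ∃ (r : ℝ) (Z : IntegralRep 0), IsAlgebraic ℚ r ∧ Z.domain = Set.univ ∧
          (Z.integrand = fun _ => r) ∧ y = of Z}) := fun q =>
    AddSubgroup.subset_closure (Or.inr ⟨(q:ℝ), Zf q, isAlgebraic_rat ℚ q, (hZf q).1,
      (hZf q).2, rfl⟩)
  have hB2 : ∀ (β : ℚ) (B : IntegralRep 2), B.domain = {x | ∀ i, x i ∈ Set.Ioo (0:ℝ) 1} →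
      EqOn B.integrand (fun x => (β : ℝ) / (1 - x 0 * x 1)) B.domain →
      of B ∈ AddSubgroup.closure ({y : FormalRep | ∃ (k : ℕ) (S : Finset ℕ) (coef : ℕ → ℝ) (N : IntegralRep (2 * (k + 1))),
          (∀ i ∈ S, IsAlgebraic ℚ (coef i)) ∧ N.domain = {x | ∀ i, x i ∈ Set.Ioo (0:ℝ) 1} ∧
          EqOn N.integrand (fun x => (∑ i ∈ S, coef i * (∏ l, x l) ^ i) / (1 - ∏ l, x l)) N.domain ∧
          y = of N} ∪
       {y : FormalRep | ∃ (w : ℕ) (c : ℝ) (N : IntegralRep w), IsAlgebraic ℚ c ∧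
          N.domain = {x | ∀ i, x i ∈ Set.Ioo (0:ℝ) 1} ∧ EqOn N.integrand (fun _ => c) N.domain ∧ y = of N} ∪
       {y : FormalRep | ∃ (r : ℝ) (Z : IntegralRep 0), IsAlgebraic ℚ r ∧ Z.domain = Set.univ ∧
          (Z.integrand = fun _ => r) ∧ y = of Z}) := fun β B hBd hBi =>
    AddSubgroup.subset_closure (Or.inl (Or.inl ⟨0, {0}, fun _ => (β:ℝ), B,
      fun _ _ => isAlgebraic_rat ℚ β, hBd, fun x hx => by
        rw [hBi hx]
        simp only [Finset.sum_singleton, pow_zero, mul_one]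
        show (β:ℝ) / (1 - x 0 * x 1) = (β:ℝ) / (1 - ∏ l : Fin 2, x l)
        rw [Fin.prod_univ_two], rfl⟩))
  -- the boxes `[□⁴, γ/(1 − Π)]`
  have hW : ∀ γ : ℚ, ∃ W : IntegralRep 4, W.domain = {x | ∀ i, x i ∈ Set.Ioo (0:ℝ) 1} ∧
      (∀ x, W.integrand x = (γ:ℝ) * (1 / (1 - x 0 * x 1 * x 2 * x 3))) ∧
      of W ∈ AddSubgroup.closure ({y : FormalRep | ∃ (k : ℕ) (S : Finset ℕ) (coef : ℕ → ℝ) (N : IntegralRep (2 * (k + 1))),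
          (∀ i ∈ S, IsAlgebraic ℚ (coef i)) ∧ N.domain = {x | ∀ i, x i ∈ Set.Ioo (0:ℝ) 1} ∧
          EqOn N.integrand (fun x => (∑ i ∈ S, coef i * (∏ l, x l) ^ i) / (1 - ∏ l, x l)) N.domain ∧
          y = of N} ∪
       {y : FormalRep | ∃ (w : ℕ) (c : ℝ) (N : IntegralRep w), IsAlgebraic ℚ c ∧
          N.domain = {x | ∀ i, x i ∈ Set.Ioo (0:ℝ) 1} ∧ EqOn N.integrand (fun _ => c) N.domain ∧ y = of N} ∪
       {y : FormalRep | ∃ (r : ℝ) (Z : IntegralRep 0), IsAlgebraic ℚ r ∧ Z.domain = Set.univ ∧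
          (Z.integrand = fun _ => r) ∧ y = of Z}) := fun γ => by
    refine ⟨Z4.constMul (γ:ℝ) (isAlgebraic_rat ℚ γ), by
      rw [IntegralRep.domain_constMul, hZ4d], fun x => by
      rw [IntegralRep.integrand_constMul, hZ4i], ?_⟩
    refine AddSubgroup.subset_closure (Or.inl (Or.inl ⟨1, {0}, fun _ => (γ:ℝ), _,
      fun _ _ => isAlgebraic_rat ℚ γ, by rw [IntegralRep.domain_constMul, hZ4d],
      fun x _ => ?_, rfl⟩))
    rw [IntegralRep.integrand_constMul, hZ4i]
    simp only [Finset.sum_singleton, pow_zero, mul_one]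
    show (γ:ℝ) * (1 / (1 - x 0 * x 1 * x 2 * x 3)) = (γ:ℝ) / (1 - ∏ l : Fin 4, x l)
    rw [Fin.prod_univ_four, mul_one_div]
  -- a family member `N` with `8[N] ≡ α[Z4]` is congruent to `[□⁴, (α/8)/(1 − Π)]`
  have hζ4 : ∀ (N : IntegralRep 4) (α : ℤ),
      (8:ℕ) • of N - ((α:ℤ) • of Z4 + (0:ℤ) • of (C1.prod Z3)) ∈ relations →
      of N ∈ AddSubgroup.closure ({y : FormalRep | ∃ (k : ℕ) (S : Finset ℕ) (coef : ℕ → ℝ) (N : IntegralRep (2 * (k + 1))),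
          (∀ i ∈ S, IsAlgebraic ℚ (coef i)) ∧ N.domain = {x | ∀ i, x i ∈ Set.Ioo (0:ℝ) 1} ∧
          EqOn N.integrand (fun x => (∑ i ∈ S, coef i * (∏ l, x l) ^ i) / (1 - ∏ l, x l)) N.domain ∧
          y = of N} ∪
       {y : FormalRep | ∃ (w : ℕ) (c : ℝ) (N : IntegralRep w), IsAlgebraic ℚ c ∧
          N.domain = {x | ∀ i, x i ∈ Set.Ioo (0:ℝ) 1} ∧ EqOn N.integrand (fun _ => c) N.domain ∧ y = of N} ∪
       {y : FormalRep | ∃ (r : ℝ) (Z : IntegralRep 0), IsAlgebraic ℚ r ∧ Z.domain = Set.univ ∧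
          (Z.integrand = fun _ => r) ∧ y = of Z}) ⊔ relations := by
    intro N α h
    obtain ⟨W, hWd, hWi, hWmem⟩ := hW ((α : ℚ) / 8)
    obtain ⟨V, hVd, hVi, -⟩ := hW (α : ℚ)
    have hVZ : of V - (α:ℤ) • of Z4 ∈ relations := by
      have h1 := aff_orbit_of_sub_sum_zsmul_mem_relations (Finset.univ : Finset (Fin 1))
        ![Z4] ![α] V (fun i _ => by fin_cases i; exact hZ4d.trans hVd.symm) fun x _ => by
          rw [hVi x]
          simp only [Finset.univ_unique, Fin.default_eq_zero, Finset.sum_singleton,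
            Matrix.cons_val_fin_one, hZ4i]
          push_cast; ring
      simpa using h1
    have hVW : of V - (8:ℤ) • of W ∈ relations := by
      have h1 := aff_orbit_of_sub_sum_zsmul_mem_relations (Finset.univ : Finset (Fin 1))
        ![W] ![8] V (fun i _ => by fin_cases i; exact hWd.trans hVd.symm) fun x _ => by
          rw [hVi x]
          simp only [Finset.univ_unique, Fin.default_eq_zero, Finset.sum_singleton,
            Matrix.cons_val_fin_one, hWi x]
          push_cast; ring
      simpa using h1
    have h8 : (8:ℕ) • (of N - of W) ∈ relations := by
      have e : (8:ℕ) • (of N - of W) = ((8:ℕ) • of N - ((α:ℤ) • of Z4 + (0:ℤ) • of (C1.prod Z3)))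
          + (of V - (8:ℤ) • of W) - (of V - (α:ℤ) • of Z4) := by
        simp only [zero_smul, add_zero, smul_sub]; abel
      rw [e]
      exact relations.sub_mem (relations.add_mem h hVW) hVZ
    have hNW : of N - of W ∈ relations := mem_relations_of_nsmul_mem (by norm_num) h8
    have e : of N = of W + (of N - of W) := by abel
    rw [e]
    exact AddSubgroup.add_mem_sup hWmem hNW
  -- the extended subgroup lies in `⟨even zeta⟩ ⊔ relations`
  have hle : AddSubgroup.closure ({y : FormalRep | ∃ (k : ℕ) (S : Finset ℕ) (coef : ℕ → ℝ) (N : IntegralRep (2 * (k + 1))),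
          (∀ i ∈ S, IsAlgebraic ℚ (coef i)) ∧ N.domain = {x | ∀ i, x i ∈ Set.Ioo (0:ℝ) 1} ∧
          EqOn N.integrand (fun x => (∑ i ∈ S, coef i * (∏ l, x l) ^ i) / (1 - ∏ l, x l)) N.domain ∧
          y = of N} ∪
       {y : FormalRep | ∃ (w : ℕ) (c : ℝ) (N : IntegralRep w), IsAlgebraic ℚ c ∧
          N.domain = {x | ∀ i, x i ∈ Set.Ioo (0:ℝ) 1} ∧ EqOn N.integrand (fun _ => c) N.domain ∧ y = of N} ∪
       {y : FormalRep | ∃ (r : ℝ) (Z : IntegralRep 0), IsAlgebraic ℚ r ∧ Z.domain = Set.univ ∧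
          (Z.integrand = fun _ => r) ∧ y = of Z} ∪
       {y : FormalRep | ∃ (m : ℕ) (p : MvPolynomial (Fin m) ℚ) (N : IntegralRep m),
          N.domain = {x | ∀ i, x i ∈ Set.Ioo (0:ℝ) 1} ∧
          EqOn N.integrand (fun x => (MvPolynomial.aeval x p : ℝ)) N.domain ∧ y = of N} ∪
       {y : FormalRep | ∃ (P : MvPolynomial (Fin 2) ℚ) (N : IntegralRep 2),
          N.domain = {x | ∀ i, x i ∈ Set.Ioo (0:ℝ) 1} ∧
          EqOn N.integrand (fun x => (MvPolynomial.aeval x P : ℝ) / (1 - x 0 * x 1)) N.domain ∧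
          y = of N} ∪
       {y : FormalRep | ∃ N : IntegralRep 2, N.domain = {x | ∀ i, x i ∈ Set.Ioo (0:ℝ) 1} ∧
          EqOn N.integrand (fun x => 1 / (1 + x 0 * x 1)) N.domain ∧ y = of N} ∪
       {y : FormalRep | ∃ N : IntegralRep 2, N.domain = {x | ∀ i, x i ∈ Set.Ioo (0:ℝ) 1} ∧
          EqOn N.integrand (fun x => 4 * x 0 * x 1 / (1 - x 0 ^ 2 * x 1 ^ 2)) N.domain ∧ y = of N} ∪
       {y : FormalRep | ∃ N : IntegralRep 2, N.domain = {x | ∀ i, x i ∈ Set.Ioo (0:ℝ) 1} ∧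
          EqOn N.integrand (fun x => 1 / (-1 - x 0 * x 1)) N.domain ∧ y = of N} ∪
       {y : FormalRep | ∃ N : IntegralRep 4, N.domain = {x | ∀ i, x i ∈ Set.Ioo (0:ℝ) 1} ∧
          EqOn N.integrand (fun x => 1 / (1 - x 0 * x 1 * x 2 * x 3)) N.domain ∧ y = of N} ∪
       {y : FormalRep | ∃ N : IntegralRep 4, N.domain = {x | ∀ i, x i ∈ Set.Ioo (0:ℝ) 1} ∧
          EqOn N.integrand (fun x => 1 / (1 + x 0 * x 1 * x 2 * x 3)) N.domain ∧ y = of N} ∪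
       {y : FormalRep | ∃ N : IntegralRep 4, N.domain = {x | ∀ i, x i ∈ Set.Ioo (0:ℝ) 1} ∧
          EqOn N.integrand (fun x => 1 / ((1 - x 0 * x 1) * (1 - x 0 * x 1 * x 2 * x 3))) N.domain ∧ y = of N} ∪
       {y : FormalRep | ∃ N : IntegralRep 4, N.domain = {x | ∀ i, x i ∈ Set.Ioo (0:ℝ) 1} ∧
          EqOn N.integrand (fun x => 1 / ((1 - x 0 * x 1 * x 2) * (1 - x 0 * x 1 * x 2 * x 3))) N.domain ∧ y = of N} ∪
       {y : FormalRep | ∃ N : IntegralRep 4, N.domain = {x | ∀ i, x i ∈ Set.Ioo (0:ℝ) 1} ∧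
          EqOn N.integrand (fun x => 1 / ((1 - x 0 * x 1) * (1 - x 2 * x 3))) N.domain ∧ y = of N} ∪
       {y : FormalRep | ∃ N : IntegralRep 4, N.domain = {x | ∀ i, x i ∈ Set.Ioo (0:ℝ) 1} ∧
          EqOn N.integrand (fun x => 1 / ((1 - x 0 * x 1) * (1 + x 2 * x 3))) N.domain ∧ y = of N} ∪
       {y : FormalRep | ∃ N : IntegralRep 4, N.domain = {x | ∀ i, x i ∈ Set.Ioo (0:ℝ) 1} ∧
          EqOn N.integrand (fun x => 1 / ((1 + x 0 * x 1) * (1 + x 2 * x 3))) N.domain ∧ y = of N}) ≤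
      AddSubgroup.closure ({y : FormalRep | ∃ (k : ℕ) (S : Finset ℕ) (coef : ℕ → ℝ) (N : IntegralRep (2 * (k + 1))),
          (∀ i ∈ S, IsAlgebraic ℚ (coef i)) ∧ N.domain = {x | ∀ i, x i ∈ Set.Ioo (0:ℝ) 1} ∧
          EqOn N.integrand (fun x => (∑ i ∈ S, coef i * (∏ l, x l) ^ i) / (1 - ∏ l, x l)) N.domain ∧
          y = of N} ∪
       {y : FormalRep | ∃ (w : ℕ) (c : ℝ) (N : IntegralRep w), IsAlgebraic ℚ c ∧
          N.domain = {x | ∀ i, x i ∈ Set.Ioo (0:ℝ) 1} ∧ EqOn N.integrand (fun _ => c) N.domain ∧ y = of N} ∪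
       {y : FormalRep | ∃ (r : ℝ) (Z : IntegralRep 0), IsAlgebraic ℚ r ∧ Z.domain = Set.univ ∧
          (Z.integrand = fun _ => r) ∧ y = of Z}) ⊔ relations := by
    refine (AddSubgroup.closure_le _).2 ?_
    rintro y ((((((((((((((hEZ1 | hEZ2) | hEZ3) | ⟨m, p, N, hNd, hNi, rfl⟩) | ⟨P, N, hNd, hNi, rfl⟩) | ⟨N, hNd, hNi, rfl⟩) | ⟨N, hNd, hNi, rfl⟩) | ⟨N, hNd, hNi, rfl⟩) | ⟨N, hNd, hNi, rfl⟩) | ⟨N, hNd, hNi, rfl⟩) | ⟨N, hNd, hNi, rfl⟩) | ⟨N, hNd, hNi, rfl⟩) | ⟨N, hNd, hNi, rfl⟩) | ⟨N, hNd, hNi, rfl⟩) | ⟨N, hNd, hNi, rfl⟩)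
    · exact AddSubgroup.mem_sup_left (AddSubgroup.subset_closure (Or.inl (Or.inl hEZ1)))
    · exact AddSubgroup.mem_sup_left (AddSubgroup.subset_closure (Or.inl (Or.inr hEZ2)))
    · exact AddSubgroup.mem_sup_left (AddSubgroup.subset_closure (Or.inr hEZ3))
    · -- a rational polynomial box is a rational point
      obtain ⟨q, hq⟩ := boxPoly_exists_pt p N hNd hNi
      have h := hq (Zf q) (hZf q).1 (hZf q).2
      have e : of N = of (Zf q) + (of N - of (Zf q)) := by abel
      rw [e]
      exact AddSubgroup.add_mem_sup (hpt q) h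
    · -- a level-one box of dimension two is `[□², β/(1−xy)] + [pt, q]`
      obtain ⟨β, q, hβq⟩ := levelOne_reduce P N hNd hNi
      obtain ⟨B, hBd, hBi⟩ := exists_zetaTwoRep β
      have h := hβq B (Zf q) hBd hBi (hZf q).1 (hZf q).2
      have e : of N = (of B + of (Zf q)) + (of N - of B - of (Zf q)) := by abel
      rw [e]
      exact AddSubgroup.add_mem_sup (AddSubgroup.add_mem _ (hB2 β B hBd hBi) (hpt q)) h
    · -- the `η(2)` box
      obtain ⟨B, hBd, hBi⟩ := exists_zetaTwoRep (1/2)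
      have h := dlk_etaTwo_sub_half N B hNd hNi hBd hBi
      have e : of N = of B + (of N - of B) := by abel
      rw [e]
      exact AddSubgroup.add_mem_sup (hB2 _ B hBd hBi) h
    · -- the squares box
      obtain ⟨B, hBd, hBi⟩ := exists_zetaTwoRep 1
      have h := dlk_squares_sub_one N B hNd hNi hBd hBi
      have e : of N = of B + (of N - of B) := by abel
      rw [e]
      exact AddSubgroup.add_mem_sup (hB2 _ B hBd hBi) h
    · -- the negative box
      obtain ⟨B, hBd, hBi⟩ := exists_zetaTwoRep (1/2)
      have h := dlk_negBox_add_half N B hNd hNi hBd hBi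
      have e : of N = -of B + (of N + of B) := by abel
      rw [e]
      exact AddSubgroup.add_mem_sup (AddSubgroup.neg_mem _ (hB2 _ B hBd hBi)) h
    · exact hζ4 N 8 (r1 N hNd hNi)
    · exact hζ4 N 7 (r2 N hNd hNi)
    · exact hζ4 N 14 (r3 N hNd hNi)
    · exact hζ4 N 10 (r4 N hNd hNi)
    · exact hζ4 N 20 (r5 N hNd hNi)
    · exact hζ4 N 10 (r8 N hNd hNi)
    · exact hζ4 N 5 (r9 N hNd hNi)
  obtain ⟨a, ha, r, hr, rfl⟩ := AddSubgroup.mem_sup.1 (hle hc)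
  have hr0 : eval r = 0 := relations_le_ker_eval_holds hr
  have ha0 : eval a = 0 := by rw [map_add, hr0, add_zero] at hv; exact hv
  exact relations.add_mem (evenZeta_mem_relations_of_eval_eq_zero_of_mem_closure ha ha0) hr

end Summit.KontsevichZagierPeriods.HurwitzMicroSectors.NormalFormPrinciple.PiBox.M3
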